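import Summits.ResolutionOfSingularities.ResolutionOfSingularities.Theorems.TowerDictionaryHolds
import Summits.ResolutionOfSingularities.ResolutionOfSingularities.Theorems.MaxContactCutTightDefect
import HarnessLib

/-!
# «TowerDictionaryHolds», slice C — the corollary: deep column aside ⟸ deep residual aside ALONE (lens-5 g39, node g39o)

With `towerDictionary_holds : TightDefectClasses.TowerDictionary` (slice B, `Theorems/TowerDictionaryHolds.lean`) the dictionary
hypothesis of the landed cut `MaxContactCutTightDefect.polyPureTowersDeep_of_defectWalksDeep` is discharged:
`MaxContactCut.PolyPureTowersDeep` (item 31769) ⟸ `MaxContactCut.DefectWalksDeep` (item 31770) alone.  PROVED (one line); no new fact.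
[folklore]
-/

set_option linter.dupNamespace false

namespace Summit.ResolutionOfSingularities.ResolutionOfSingularities.Theorems.TowerDictionaryHolds

/-- **Corollary (deep column aside ⟸ deep residual aside ALONE).**  With the dictionary discharged,
`MaxContactCut.PolyPureTowersDeep` (item 31769) follows from `MaxContactCut.DefectWalksDeep` (item 31770) by the landed cut
`MaxContactCutTightDefect.polyPureTowersDeep_of_defectWalksDeep`. [folklore] -/
theorem polyPureTowersDeep_of_defectWalksDeep
    (hΔ : Summit.ResolutionOfSingularities.ResolutionOfSingularities.Theses.MaxContactCut.DefectWalksDeep) :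
    Summit.ResolutionOfSingularities.ResolutionOfSingularities.Theses.MaxContactCut.PolyPureTowersDeep :=
  Summit.ResolutionOfSingularities.ResolutionOfSingularities.Theorems.MaxContactCutTightDefect.polyPureTowersDeep_of_defectWalksDeep
    towerDictionary_holds hΔ

end Summit.ResolutionOfSingularities.ResolutionOfSingularities.Theorems.TowerDictionaryHolds
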